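import Summits.HubbardSuperconductivity.HubbardSuperconductivity.Theorems.AnisotropyChordTransferFibre3FinXDSideZ

/-!
# Route `AnisotropyChord` / H0 rotor rung: FIN per-`L` SIDE-CONDITION cell facts, `L = 12` (GM₃ cells 168–170)

Kernel facts `sdCellAnyZ 12 (49/50) 20 la lb (c, bn, aD) = true` (regime clause `mHole ≥ 0 ∧ facMI·η·(aD + b/(2+cos θ)) < c` on the cell, or vacuity), g5's `xbEval` objects, `decide +kernel`.
Prover seat `hubbard-h0-rotor-p3` g7; helper for piece A = stmt-HubbardSuperconductivity-23918 of rung 19089 (`--supports`, helper class).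
WHAT THIS IS NOT: nothing here proves superconductivity in the Hubbard model (rotor TARGET as worded stays FALSE, g15 verdict); kernel facts /
assembly for ONE conditional reduction at one `L`.  No sorry.
-/

set_option linter.dupNamespace false
set_option autoImplicit false

namespace Summit.HubbardSuperconductivity.HubbardSuperconductivity.Theorems.AnisotropyChord.Transfer.Fibre3

namespace FinXD

/-- side-condition cell `[17635092182851503, 17846713289045723]` of `L = 12` (`cert`). [folklore] -/
theorem sd12_168 : sdCellAnyZ 12 (49/50 : ℚ) 20 17635092182851503 17846713289045723 ((9/20 : ℚ), (30 : ℕ), (1/20 : ℚ)) = true := by decide +kernel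

/-- side-condition cell `[17846713289045723, 26770069933568585]` of `L = 12` (`num`). [folklore] -/
theorem sd12_169 : sdCellAnyZ 12 (49/50 : ℚ) 20 17846713289045723 26770069933568585 ((1 : ℚ), (1 : ℕ), (1 : ℚ)) = true := by decide +kernel

/-- side-condition cell `[26770069933568585, 31039053697696364]` of `L = 12` (`num`). [folklore] -/
theorem sd12_170 : sdCellAnyZ 12 (49/50 : ℚ) 20 26770069933568585 31039053697696364 ((1 : ℚ), (1 : ℕ), (1 : ℚ)) = true := by decide +kernel

end FinXD

end Summit.HubbardSuperconductivity.HubbardSuperconductivity.Theorems.AnisotropyChord.Transfer.Fibre3
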